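import Literature.MathematicalPhysics.KineticTheory.KickMatchedSwapRestart
import Literature.Probability.LatticeModels.ProductMeasureTools
import HarnessLib

/-!
# Resampling orthogonality for i.i.d. dice, and what a driven hard-sphere orbit sees of its dice

Topic `Literature/MathematicalPhysics/KineticTheory` (crux `stmt-AtomisticToContinuum-13914`, line
`stein-lindeberg-kick-swap`, stub S1 `FairGasContactChaos`, piece M "mark martingale": the conditional-orthogonality
step). Two elementary facts that make the mark piece of the defect of the kick-matched gas `Z*` a sum of UNCORRELATED
increments:

* `KernelGas.integral_dice_mul_eq_zero_of_update` — **resampling orthogonality** for the i.i.d. dice law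
  `KernelGas.dice ν = ν^{⊗ℕ}`: if `H` does not depend on die `n` and `D` has `ν`-mean zero in die `n` for almost every
  value of the other dice, then `∫ H · D d(dice ν) = 0` (bounded measurable `H, D`). Proof: resampling die `n`
  independently leaves the law invariant (`Literature.Probability.LatticeModels.map_update_infinitePi_prod`), then
  Fubini. This is `E[H (D − E[D | 𝓕ₙᶜ])] = 0`, the orthogonality of martingale differences, in the form needed for
  increments indexed by collisions;
* `Driven.stateAfter_update_of_le`, `Driven.instant_update_of_le` — **the past of a driven orbit does not see future
  dice**: the post-collisional states `z_k`, `k ≤ n`, and the instants `t_k`, `k ≤ n + 1`, of `Driven.stateAfter /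
  instant G ε R ξs z` are unchanged when die `n` (consumed by collision `n + 1`) is replaced.

With the one-step mark identity (`KickMatchedMarkMartingale.integral_dice_markAt_sub_admFluxMean_eq_zero`) these give:
the increments `χ(Ψ(markₖ) − admFluxMeanₖ)` of `markPiece` along `Z*`, weighted by any bounded function of the
earlier dice, are pairwise orthogonal in `L²(localGibbsLaw ⊗ kmDice)`.

References: S. Chatterjee, *A generalization of the Lindeberg principle*, Ann. Probab. 34 (2006) (swap one input at a
time) [Chatterjee2006]; D. Williams, *Probability with Martingales* (1991), §12.1 (orthogonality of martingale
increments) [Williams1991]. Elementary, tagged `[folklore]`.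
-/

noncomputable section

open scoped BigOperators ENNReal Topology
open MeasureTheory Set Filter
open Literature.Analysis.FluidPDE

namespace Literature.MathematicalPhysics.KineticTheory

/-! ## Resampling orthogonality for i.i.d. dice -/

namespace KernelGas

variable {U : Type*} [MeasurableSpace U] (ν : Measure U) [IsProbabilityMeasure ν]

/-- `dice ν` is Mathlib's `Measure.infinitePi` of the constant family (definitional). [folklore] -/
theorem dice_eq_infinitePi : dice ν = Measure.infinitePi fun _ : ℕ => ν := rfl

/-- **Resampling one die leaves the dice law invariant**: `(u, x) ↦ update u n x` pushes `dice ν ⊗ ν` to `dice ν`.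
[folklore] -/
theorem map_update_dice_prod (n : ℕ) :
    ((dice ν).prod ν).map (fun p : (ℕ → U) × U => Function.update p.1 n p.2) = dice ν := by
  have h := Literature.Probability.LatticeModels.map_update_infinitePi_prod (fun _ : ℕ => ν) n
  exact h

/-- **Resampling orthogonality** (orthogonality of martingale differences, collision-indexed form): if `H` does not
depend on die `n`, `D` has `ν`-mean zero in die `n` for `dice ν`-a.e. value of the dice, and both are bounded and
measurable, then `∫ H u * D u ∂(dice ν) = 0`. [folklore] -/
theorem integral_dice_mul_eq_zero_of_update (n : ℕ) {H D : (ℕ → U) → ℝ} (hHm : Measurable H) (hDm : Measurable D)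
    {CH CD : ℝ} (hHb : ∀ u, |H u| ≤ CH) (hDb : ∀ u, |D u| ≤ CD)
    (hH : ∀ u x, H (Function.update u n x) = H u)
    (hD : ∀ᵐ u ∂(dice ν), ∫ x, D (Function.update u n x) ∂ν = 0) :
    ∫ u, H u * D u ∂(dice ν) = 0 := by
  have hupd : Measurable fun p : (ℕ → U) × U => Function.update p.1 n p.2 := measurable_update'
  have hFm : Measurable fun u : ℕ → U => H u * D u := hHm.mul hDm
  -- resample die `n`
  rw [← map_update_dice_prod ν n, integral_map hupd.aemeasurable hFm.aestronglyMeasurable]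
  -- Fubini
  have hint : Integrable (fun p : (ℕ → U) × U => H (Function.update p.1 n p.2) * D (Function.update p.1 n p.2))
      ((dice ν).prod ν) := by
    refine Integrable.of_bound (C := CH * CD) (hFm.comp hupd).aestronglyMeasurable (Filter.Eventually.of_forall fun p => ?_)
    set w : ℕ → U := Function.update p.1 n p.2
    rw [Real.norm_eq_abs, abs_mul]
    exact mul_le_mul (hHb w) (hDb w) (abs_nonneg (D w)) ((abs_nonneg (H w)).trans (hHb w))
  rw [integral_prod _ hint]
  simp only [hH]
  simp_rw [integral_const_mul]
  refine integral_eq_zero_of_ae ?_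
  filter_upwards [hD] with u hu
  simp [hu]

end KernelGas

/-! ## The past of a driven orbit does not see future dice -/

namespace Driven

variable {d : Type*} [Fintype d] {X : Type*} {N : ℕ} {Ξ : Type*}
variable {G : Geometry d X} {ε : ℝ} {R : Fin N → Fin N → Config N d X → Ξ → Config N d X}

/-- **`z_k` does not depend on die `n` for `k ≤ n`** (collision `k` consumes die `k − 1`). [folklore] -/
theorem stateAfter_update_of_le [DecidableEq ℕ] (ξs : ℕ → Ξ) (z : Config N d X) {n k : ℕ} (hk : k ≤ n) (x : Ξ) :
    stateAfter G ε R (Function.update ξs n x) z k = stateAfter G ε R ξs z k := by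
  induction k with
  | zero => rfl
  | succ k ih =>
    rw [stateAfter_succ, stateAfter_succ, ih (Nat.le_of_succ_le hk), Function.update_of_ne (by omega)]

/-- **`t_k` does not depend on die `n` for `k ≤ n + 1`**. [folklore] -/
theorem instant_update_of_le [DecidableEq ℕ] (ξs : ℕ → Ξ) (z : Config N d X) {n k : ℕ} (hk : k ≤ n + 1) (x : Ξ) :
    instant G ε R (Function.update ξs n x) z k = instant G ε R ξs z k := by
  unfold instant
  refine Finset.sum_congr rfl fun m hm => ?_
  rw [stateAfter_update_of_le ξs z (by have := Finset.mem_range.1 hm; omega) x]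

/-- The pre-collisional configuration of collision `n + 1` (the exit configuration of `z_n`) does not depend on die
`n`. [folklore] -/
theorem freeFlight_stateAfter_update_self [DecidableEq ℕ] (ξs : ℕ → Ξ) (z : Config N d X) (n : ℕ) (x : Ξ) :
    freeFlight G (Alexander.freeExitTime G ε (stateAfter G ε R (Function.update ξs n x) z n)).toReal
        (stateAfter G ε R (Function.update ξs n x) z n) =
      freeFlight G (Alexander.freeExitTime G ε (stateAfter G ε R ξs z n)).toReal (stateAfter G ε R ξs z n) := by
  rw [stateAfter_update_of_le ξs z le_rfl x]

/-- **Collision `n + 1` of the resampled orbit**: with die `n` replaced by `x`, the post-collisional state `z_{n+1}` is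
`step x z_n` of the ORIGINAL `z_n`. [folklore] -/
theorem stateAfter_succ_update_self [DecidableEq ℕ] (ξs : ℕ → Ξ) (z : Config N d X) (n : ℕ) (x : Ξ) :
    stateAfter G ε R (Function.update ξs n x) z (n + 1) = step G ε R x (stateAfter G ε R ξs z n) := by
  rw [stateAfter_succ, stateAfter_update_of_le ξs z le_rfl x, Function.update_self]

end Driven

end Literature.MathematicalPhysics.KineticTheory

end
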